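import Literature.NumberTheory.PAdicHodge.AinfWeierstrassOmegaPeriod
import HarnessLib

/-!
# `∫_t ω ≡ [t] (mod Fil² B_dR⁺)`: the ω-period modulo `Fil²` is Fontaine's element (Hodge–Tate level)

Topic `Literature/NumberTheory/PAdicHodge`; sequel of `AinfWeierstrassOmegaPeriod`. Since `log_W(T) = T + O(T²)`
(Silverman AEC IV.5.5, tree `coeff_one_formalLog`) and `[t] ∈ Fil¹ = (ξ_dR)`, the `ξ`-adic evaluation gives
`∫_t ω = log_W([t]) ≡ [t] (mod Fil²)`. So the class of `∫_t ω` in `gr¹B_dR = Fil¹/Fil² ≅ ℂ_F(1)` is the class of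
Fontaine's element `[t]`, i.e. `θ([t]/ξ)·(ξ mod ξ²)`: the Hodge–Tate component of the period map of `Ŵ` (Tate 1967 §4;
Fontaine 1982 §5) is read off from `[t] ∈ 𝔸_inf` alone. Contents:

* `BdRPlusTop.evalPt₁_sub_self_mem_sq` — for `f ∈ ℚ⟦T⟧` with `f(0) = 0`, `f'(0) = 1` and `x ∈ Fil¹`:
  `f(x) - x ∈ Fil²` (general);
* **`AinfTop.omegaPeriod_sub_torsionLiftFil_mem_sq`** — `∫_t ω - [t] ∈ Fil² B_dR⁺`.

No definitions, no named facts, no `sorry`. Non-vanishing of this class for a generator `t` of `T_pŴ` (Tate's theorem,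
the non-degeneracy input of the supersingular sector of hDR) is NOT proved here.

## References
* J. T. Tate, *p-divisible groups* (Driebergen 1966), Springer 1967, §4. [Tate1967]
* J.-M. Fontaine, *Formes différentielles et modules de Tate…*, Invent. Math. 65 (1982), §5. [Fontaine1982FormesDifferentielles]
* J. H. Silverman, *The Arithmetic of Elliptic Curves* (2009), IV.5.5. [SilvermanAEC2009]
-/

noncomputable section

open Ideal Field WittVector MvPowerSeries

namespace Literature.NumberTheory.PAdicHodge

open Literature.NumberTheory.GaloisRepresentations
open Literature.NumberTheory.GaloisRepresentations.IsNonarchimedeanLocalField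
open Literature.NumberTheory.GaloisRepresentations.LubinTate

variable {F : Type} [Field F] [ValuativeRel F] [TopologicalSpace F] [IsNonarchimedeanLocalField F] [CharZero F]
  {p : ℕ} [Fact p.Prime] [Fact (¬ IsUnit (p : integerC F))]
  [IsAdicComplete (Ideal.span {(p : integerC F)}) (integerC F)]

namespace BdRPlusTop

/-- `f = T·(T·f₂ + 1)` for `f ∈ A⟦T⟧` with `f(0) = 0`, `f'(0) = 1`, where `f₂ = Σ aₙ₊₂ Tⁿ`. [cite: SilvermanAEC2009, IV.5.5] -/
private theorem eq_X_mul_of_coeff {A : Type*} [CommRing A] (f : PowerSeries A) (hf0 : PowerSeries.constantCoeff f = 0)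
    (hf1 : PowerSeries.coeff 1 f = 1) :
    f = PowerSeries.X * (PowerSeries.X * PowerSeries.mk (fun n => PowerSeries.coeff (n + 1)
      (PowerSeries.mk fun m => PowerSeries.coeff (m + 1) f)) + 1) := by
  have h1 := PowerSeries.eq_X_mul_shift_add_const f
  have h2 := PowerSeries.eq_X_mul_shift_add_const (PowerSeries.mk fun m => PowerSeries.coeff (m + 1) f)
  have hc : PowerSeries.constantCoeff (PowerSeries.mk fun m => PowerSeries.coeff (m + 1) f) = 1 := by
    rw [← PowerSeries.coeff_zero_eq_constantCoeff_apply, PowerSeries.coeff_mk, zero_add, hf1]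
  rw [hc, map_one] at h2
  rw [hf0, map_zero, add_zero, h2] at h1
  exact h1

/-- **`f(x) ≡ x (mod Fil²)`** for `f ∈ ℚ⟦T⟧` with `f(0) = 0`, `f'(0) = 1` and `x ∈ Fil¹ B_dR⁺` (e.g. `f = log_𝔉`).
[cite: FontaineAsterisque223III, Exp. II §1.5.4] -/
theorem evalPt₁_sub_self_mem_sq (f : PowerSeries RatCoeff) (hf0 : PowerSeries.constantCoeff f = 0)
    (hf1 : PowerSeries.coeff 1 f = 1) (x : (filOne F p).toIdeal) :
    (evalPt₁ (filOne F p) f hf0 x : BdRPlusTop F p) - x ∈ (WithIdeal.i ^ 2 : Ideal (BdRPlusTop F p)) := by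
  set f₂ : PowerSeries RatCoeff := PowerSeries.mk (fun n => PowerSeries.coeff (n + 1)
      (PowerSeries.mk fun m => PowerSeries.coeff (m + 1) f)) with hf₂
  have hdec := eq_X_mul_of_coeff f hf0 hf1
  rw [← hf₂] at hdec
  have hX : aeval ((filOne F p).hasEval fun _ : Unit => x) (PowerSeries.X : PowerSeries RatCoeff) = (x : BdRPlusTop F p) :=
    aeval_X' ((filOne F p).hasEval fun _ : Unit => x) ()
  have hval : (evalPt₁ (filOne F p) f hf0 x : BdRPlusTop F p) =
      (x : BdRPlusTop F p) * ((x : BdRPlusTop F p) * aeval ((filOne F p).hasEval fun _ : Unit => x) f₂ + 1) := by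
    change aeval ((filOne F p).hasEval fun _ : Unit => x) f = _
    conv_lhs => rw [hdec]
    rw [map_mul, map_add, map_mul, map_one, hX]
  rw [hval, show (x : BdRPlusTop F p) * ((x : BdRPlusTop F p) * aeval ((filOne F p).hasEval fun _ : Unit => x) f₂ + 1) - x =
      (x : BdRPlusTop F p) * x * aeval ((filOne F p).hasEval fun _ : Unit => x) f₂ by ring, pow_two]
  exact Ideal.mul_mem_right _ _ (Ideal.mul_mem_mul x.2 x.2)

end BdRPlusTop

namespace AinfTop

variable {hθ : Function.Surjective (fontaineTheta (integerC F) p)} (W : WeierstrassCurve ℤ)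

omit [CharZero F] [Fact p.Prime] [Fact (¬ IsUnit (p : integerC F))] [IsAdicComplete (Ideal.span {(p : integerC F)}) (integerC F)] in
/-- `log_W'(0) = 1`. [cite: SilvermanAEC2009, IV.5.5] -/
theorem coeff_one_logSeries : PowerSeries.coeff 1 (logSeries W) = 1 := by
  rw [logSeries, PowerSeries.coeff_map, WeierstrassCurve.coeff_one_formalLog, map_one]

/-- **`∫_t ω ≡ [t] (mod Fil² B_dR⁺)`**: the ω-period and Fontaine's element agree in `gr¹ B_dR ≅ ℂ_F(1)` (the
Hodge–Tate level of the period map of `Ŵ`). [cite: Fontaine1982FormesDifferentielles, §5] [cite: SilvermanAEC2009, IV.5.5] -/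
theorem omegaPeriod_sub_torsionLiftFil_mem_sq {t : ℕ → (maxNilIdealC F).toIdeal} (ht0 : (t 0 : CBall F) = 0)
    (htp : ∀ n, mulPC F p W (t (n + 1)) = t n) :
    omegaPeriod W hθ t ht0 htp - (torsionLiftFil W hθ t ht0 htp : BdRPlusTop F p) ∈
      (WithIdeal.i ^ 2 : Ideal (BdRPlusTop F p)) :=
  BdRPlusTop.evalPt₁_sub_self_mem_sq (logSeries W) (constantCoeff_logSeries W) (coeff_one_logSeries W) _

end AinfTop

end Literature.NumberTheory.PAdicHodge

end
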